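import Summits.ResolutionOfSingularities.ResolutionOfSingularities.Theorems.HilbertSamuelEliminationCampaignW42VertexGame
import Summits.ResolutionOfSingularities.ResolutionOfSingularities.Theorems.HilbertSamuelEliminationCampaignW42VertexGameRank
import Mathlib.Data.Prod.Lex
import Mathlib.Data.Fintype.Fin
import Mathlib.Order.WellFounded

/-!
# [OURS · L1 W4.2] The CJS label strategy wins the one-vertex polyhedra game in dimension 3
# (proof file 2 of 2 for `…CampaignW42VertexGame.lean`; `--supports stmt-ResolutionOfSingularities-19965`)

HONEST FRAMING. OURS (seat res-L1-s42-pv-2, slot W4.2 / obstruction O2); nothing here is a statement of H. Hironaka's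
manuscript [Hironaka2017]; AI-made, AI review is weaker than expert review. A theorem about the validated combinatorial
MODEL of the CJS walk on binomial threefolds `y^m + x^a` at torus-fixed points (CALIBRATION-W42-O2-v2 §3d: 30 904 engine
edges reproduced, 0 discrepancies), not about schemes; the O2 items 19964/19965 and the chain's CORE stay OPEN.

MAIN RESULTS (namespace `…Theorems.CampaignW42.VertexGame`).
* `good_of_step` — (L1) after ANY move the oldest class is `Good` (never «plane + disjoint line», never «three planes»):
  the new oldest components containing the chart coordinate are all inheritors or all fresh, and a bad class would have to
  contain one of them and a disjoint old one.
* `rank_lt_of_step` — (L2) from a `Good` position every move strictly lowers `rank = (rho1, arr0, exc0)`: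
  END on the single oldest component `S₀` keeps `rho1` and lowers the excess while `S₀` persists, and lowers `rho1` when it
  dies; an arrangement move into chart `c` either lowers `|a|` (when `a_{U ∖ c} < m`) or leaves exactly ONE oldest component
  `U ∖ {c}` with `rho1` unchanged — the «+ excess, repaid before anything else acts» bookkeeping of the z3 certificate
  (kit j272088, all `m ≥ 1`, `a ∈ ℕ³`, labellings, charts).
* `labelStrategyWins : 0 < m → LabelStrategyWins m` — every play is finite. [OURS · L1 W4.2] replaces the role of the CORE
  row `stub_Wtop3M_nonpointed` / items `CampaignW42NearChainTermination`, `CampaignW42TertiaryTermination` ON THE BINOMIAL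
  FAMILY (first kernel instance in the `ē = 3` territory; RESCUE-SEED W4.2; CRUX-PLAN w42 v3.6 §000000 (5)(a)).
-/

set_option linter.dupNamespace false -- mandated namespace of this single-conjunct summit

namespace Summit.ResolutionOfSingularities.ResolutionOfSingularities.Theorems

namespace CampaignW42.VertexGame

open Finset

variable {m : ℕ}

/-! ## Finite combinatorics of index sets in `{0,1,2}` -/

/-- Two incomparable nonempty index sets are disjoint or cover all three coordinates. [folklore] -/
theorem disjoint_or_union_eq_univ : ∀ S T : Finset (Fin 3), S.Nonempty → T.Nonempty → ¬ S ⊆ T → ¬ T ⊆ S →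
    Disjoint S T ∨ S ∪ T = univ := by
  decide

/-- Two incomparable, non-disjoint, covering index sets are pairs: every coordinate is PROPERLY inside one. [folklore] -/
theorem singleton_ssubset_of_union_eq_univ : ∀ (S T : Finset (Fin 3)) (x : Fin 3), ¬ S ⊆ T → ¬ T ⊆ S →
    ¬ Disjoint S T → S ∪ T = univ → ({x} ⊂ S ∨ {x} ⊂ T) := by
  decide

/-- Nonempty proper subsets of a coordinate pair `{0,1,2} ∖ {c}` are singletons. [folklore] -/
theorem eq_singleton_of_ssubset_erase : ∀ (c : Fin 3) (T : Finset (Fin 3)), T ⊂ univ.erase c → T.Nonempty →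
    ∃ x, x ≠ c ∧ T = {x} := by
  decide

/-- Two disjoint nonempty index sets avoiding a common coordinate are singletons. [folklore] -/
theorem card_eq_one_of_disjoint : ∀ (S T : Finset (Fin 3)) (x : Fin 3), S.Nonempty → T.Nonempty → Disjoint S T →
    x ∉ S → x ∉ T → S.card = 1 := by
  decide

/-- … and no third nonempty index set avoiding that coordinate is incomparable with both. [folklore] -/
theorem not_third_of_disjoint : ∀ (S T V : Finset (Fin 3)) (x : Fin 3), S.Nonempty → T.Nonempty → Disjoint S T →
    x ∉ S → x ∉ T → V.Nonempty → x ∉ V → ¬ S ⊆ V → ¬ T ⊆ V → False := by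
  decide

/-- A coordinate pair is nonempty. [folklore] -/
theorem erase_univ_nonempty : ∀ c : Fin 3, (univ.erase c : Finset (Fin 3)).Nonempty := by
  decide

/-! ## (L1) Every successor position is `Good` -/

/-- **(L1)** After any move the new position is `Good`: its oldest class is never «plane + disjoint line» nor «three
planes». [folklore] -/
theorem good_of_step {s s' : State} (h : Step m s s') : Good m s' := by
  rintro ⟨⟨S, hS, T, hT, hST⟩, hcov⟩
  obtain ⟨isEnd, U, c, hcen, hcU, ha, hlab⟩ := h
  obtain ⟨R, hR, hcR⟩ := hcov c
  have hRc' : R ∈ comps m s'.a := mem_comps_of_mem_leastClass hR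
  have key : ∀ W ∈ leastClass m s', c ∈ W := by
    intro W hW
    by_contra hcW
    have hWc' : W ∈ comps m s'.a := mem_comps_of_mem_leastClass hW
    have hWc : W ∈ comps m s.a := mem_comps_of_mem_comps_transform hcW (ha ▸ hWc')
    have hlabW : s'.lab W = s.lab W := by rw [hlab W hWc']; simp [newLabel, hcW]
    have heq : s'.lab W = s'.lab R :=
      le_antisymm ((mem_leastClass.1 hW).2 R hRc') ((mem_leastClass.1 hR).2 W hWc')
    by_cases hcase : isEnd = true ∧ R ⊆ U
    · have hlabR : s'.lab R = s.lab U := by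
        rw [hlab R hRc']; simp [newLabel, hcR, hcase.1, hcase.2]
      obtain ⟨hE, hRU⟩ := hcase
      subst hE
      cases hcen with
      | end_ S₀ hLC =>
        have hU : U ∈ leastClass m s := by rw [hLC]; exact mem_singleton_self _
        have hWL : W ∈ leastClass m s := mem_leastClass_of_lab_eq hU hWc (by rw [← hlabW, heq, hlabR])
        rw [hLC, mem_singleton] at hWL
        exact hcW (hWL ▸ hcU)
    · have hlabR : s'.lab R = fresh m s := by
        rw [hlab R hRc']
        simp only [newLabel, hcR, not_true_eq_false, if_false]
        rw [if_neg hcase]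
      have hlt := lab_lt_fresh hWc
      rw [← hlabW, heq, hlabR] at hlt
      exact lt_irrefl _ hlt
  exact Finset.disjoint_left.1 hST (key S hS) (key T hT)

/-! ## (L2) The rank drops — END moves -/

/-- END move on the single oldest component `U`, followed into chart `c ∈ U`: the rank drops. If `U` is still big it
stays the single oldest component, `rho1` is unchanged and the excess drops by `m − a_{U ∖ c} ≥ 1`; if not, `rho1` drops.
[folklore] -/
theorem rank_lt_of_step_end (hm : 0 < m) {s s' : State} {U : Finset (Fin 3)} {c : Fin 3}
    (hLC : leastClass m s = {U}) (hcU : c ∈ U) (ha : s'.a = transform m s.a U c)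
    (hlab : ∀ S ∈ comps m s'.a, s'.lab S = newLabel m s true U c S) : rank m s' < rank m s := by
  have hU : U ∈ leastClass m s := by rw [hLC]; exact mem_singleton_self _
  have hUc : U ∈ comps m s.a := mem_comps_of_mem_leastClass hU
  have hbig : m ≤ ∑ i ∈ U, s.a i := le_sum_of_mem_comps hUc
  have hsplit : ∑ i ∈ U, s.a i = s.a c + ∑ i ∈ U.erase c, s.a i := (add_sum_erase U s.a hcU).symm
  have hr : ∑ i ∈ U.erase c, s.a i < m := sum_lt_of_ssubset' hm hUc (erase_ssubset hcU)
  have harr : arr0 m s = 1 := by simp [arr0, hLC]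
  have hexc : exc0 m s = ∑ i ∈ U, s.a i - m := by simp [exc0, hLC]
  have hrho : rho1 m s = total s.a - (∑ i ∈ U, s.a i - m) := by simp [rho1, harr, hexc]
  have htot := total_transform (m := m) (a := s.a) (c := c) hbig
  rw [← ha] at htot
  have hUle : ∑ i ∈ U, s.a i ≤ total s.a := sum_le_total _ _
  have hU' : ∑ i ∈ U, s'.a i + m = ∑ i ∈ U, s.a i + ∑ i ∈ U.erase c, s.a i := by
    rw [ha]; exact sum_transform_of_mem hcU hbig
  have hlabU' : ∀ hUc' : U ∈ comps m s'.a, s'.lab U = s.lab U := fun hUc' => by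
    rw [hlab U hUc']; simp [newLabel, hcU]
  rw [rank_lt_iff]
  by_cases hpers : m ≤ ∑ i ∈ U, s'.a i
  · -- `U` persists as a component and stays the single oldest one
    have hUc' : U ∈ comps m s'.a := by
      refine mem_comps_of (nonempty_of_mem_comps hUc) hpers fun T hT hTne => ?_
      by_cases hcT : c ∈ T
      · have h1 : ∑ i ∈ T, s'.a i + m = ∑ i ∈ U, s.a i + ∑ i ∈ T.erase c, s.a i := by
          rw [ha]; exact sum_transform_of_mem hcT hbig
        have h2 : ∑ i ∈ T, s.a i < m := sum_lt_of_ssubset hUc hT hTne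
        have h3 : ∑ i ∈ T, s.a i = s.a c + ∑ i ∈ T.erase c, s.a i := (add_sum_erase T s.a hcT).symm
        omega
      · rw [ha, sum_transform_of_not_mem hcT]; exact sum_lt_of_ssubset hUc hT hTne
    have hLC' : leastClass m s' = {U} := by
      ext W
      simp only [mem_singleton]
      constructor
      · intro hW
        have hWc' := mem_comps_of_mem_leastClass hW
        by_contra hne
        have hle : s'.lab W ≤ s'.lab U := (mem_leastClass.1 hW).2 U hUc'
        rw [hlabU' hUc'] at hle
        by_cases hcW : c ∈ W
        · have hWf : s'.lab W = fresh m s := by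
            rw [hlab W hWc']
            simp only [newLabel, hcW, not_true_eq_false, if_false, true_and]
            rw [if_neg]
            exact fun hWU => hne (eq_of_subset_of_mem_comps hUc' hWc' hWU)
          have := lab_lt_fresh hUc
          omega
        · have hWc : W ∈ comps m s.a := mem_comps_of_mem_comps_transform hcW (ha ▸ hWc')
          have hWL : W ∉ leastClass m s := by rw [hLC, mem_singleton]; exact hne
          have := lab_lt_of_not_mem_leastClass hU hWc hWL
          have hlabW : s'.lab W = s.lab W := by rw [hlab W hWc']; simp [newLabel, hcW]
          omega
      · rintro rfl
        refine mem_leastClass.2 ⟨hUc', fun T hT => ?_⟩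
        rw [hlabU' hUc', hlab T hT]
        by_cases hcT : c ∈ T
        · simp only [newLabel, hcT, not_true_eq_false, if_false, true_and]
          split_ifs with hTU
          · exact le_rfl
          · exact le_of_lt (lab_lt_fresh hUc)
        · simp only [newLabel, hcT, not_false_eq_true, if_true]
          exact (mem_leastClass.1 hU).2 T (mem_comps_of_mem_comps_transform hcT (ha ▸ hT))
    have harr' : arr0 m s' = 1 := by simp [arr0, hLC']
    have hexc' : exc0 m s' = ∑ i ∈ U, s'.a i - m := by simp [exc0, hLC']
    have hrho' : rho1 m s' = total s'.a - (∑ i ∈ U, s'.a i - m) := by simp [rho1, harr', hexc']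
    have hUle' : ∑ i ∈ U, s'.a i ≤ total s'.a := sum_le_total _ _
    right
    exact ⟨by omega, Or.inr ⟨by omega, by omega⟩⟩
  · -- `U` dies: `rho1` drops
    left
    have := rho1_le_total (m := m) (s := s')
    omega

/-! ## (L2) The rank drops — arrangement moves -/

/-- The survivor of an arrangement move from a `Good` position. Let `U` be the flat (union of ≥ 2 oldest index sets),
`c ∈ U` the chart and `R = U ∖ {c}`. If `a_R ≥ m` then `R` is an (old) component, and every other old component avoiding
`c` is strictly newer than `R` — so `R` will be the ONLY oldest component after the move. (By `Good`, the oldest class is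
either two planes `{j}, {k}` — then `R` is the other plane — or consists of lines — then `U` is everything and `R` is the
complementary line.) [folklore] -/
theorem arr_survivor {s : State} (hG : Good m s) {sub : Finset (Finset (Fin 3))} {c : Fin 3}
    (hsub : sub ⊆ leastClass m s) (hcard : 2 ≤ sub.card) (hcU : c ∈ sub.biUnion id)
    (hR : m ≤ ∑ i ∈ (sub.biUnion id).erase c, s.a i) :
    (sub.biUnion id).erase c ∈ comps m s.a ∧
      ∀ W ∈ comps m s.a, c ∉ W → W ≠ (sub.biUnion id).erase c → s.lab ((sub.biUnion id).erase c) < s.lab W := by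
  set U := sub.biUnion id with hUdef
  obtain ⟨S1, hS1, S2, hS2, hne⟩ := (Finset.one_lt_card (s := sub)).1 (by omega)
  have hS1L := hsub hS1
  have hS2L := hsub hS2
  have hS1c := mem_comps_of_mem_leastClass hS1L
  have hS2c := mem_comps_of_mem_leastClass hS2L
  have hS1ne := nonempty_of_mem_comps hS1c
  have hS2ne := nonempty_of_mem_comps hS2c
  have h12 : ¬ S1 ⊆ S2 := fun h => hne (eq_of_subset_of_mem_comps hS2c hS1c h)
  have h21 : ¬ S2 ⊆ S1 := fun h => hne (eq_of_subset_of_mem_comps hS1c hS2c h).symm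
  have hS1U : S1 ⊆ U := subset_biUnion_of_mem id hS1
  have hS2U : S2 ⊆ U := subset_biUnion_of_mem id hS2
  rcases disjoint_or_union_eq_univ S1 S2 hS1ne hS2ne h12 h21 with hdis | hcov
  · -- two disjoint oldest components: by `Good` they do not cover, so both are planes and nothing else is oldest
    have hncov : ∃ x, ∀ W ∈ leastClass m s, x ∉ W := by
      by_contra hall
      push Not at hall
      exact hG ⟨⟨S1, hS1L, S2, hS2L, hdis⟩, hall⟩
    obtain ⟨x, hx⟩ := hncov
    have honly : ∀ V ∈ leastClass m s, V = S1 ∨ V = S2 := by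
      intro V hV
      by_contra hV'
      rw [not_or] at hV'
      have hVc := mem_comps_of_mem_leastClass hV
      exact not_third_of_disjoint S1 S2 V x hS1ne hS2ne hdis (hx S1 hS1L) (hx S2 hS2L)
        (nonempty_of_mem_comps hVc) (hx V hV)
        (fun h => hV'.1 (eq_of_subset_of_mem_comps hVc hS1c h).symm)
        (fun h => hV'.2 (eq_of_subset_of_mem_comps hVc hS2c h).symm)
    have hUeq : U = S1 ∪ S2 := by
      refine Subset.antisymm (fun y hy => ?_) (union_subset hS1U hS2U)
      obtain ⟨V, hV, hyV⟩ := mem_biUnion.1 hy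
      rcases honly V (hsub hV) with rfl | rfl
      · exact mem_union_left _ hyV
      · exact mem_union_right _ hyV
    obtain ⟨P, Q, hPL, hQL, hPQ, hcP, hUPQ, honly'⟩ : ∃ P Q, P ∈ leastClass m s ∧ Q ∈ leastClass m s ∧
        Disjoint P Q ∧ c ∈ P ∧ U = P ∪ Q ∧ ∀ V ∈ leastClass m s, V = P ∨ V = Q := by
      rcases mem_union.1 (hUeq ▸ hcU) with hc | hc
      · exact ⟨S1, S2, hS1L, hS2L, hdis, hc, hUeq, honly⟩
      · exact ⟨S2, S1, hS2L, hS1L, hdis.symm, hc, hUeq.trans (union_comm _ _),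
          fun V hV => (honly V hV).symm⟩
    have hPc := mem_comps_of_mem_leastClass hPL
    have hQc := mem_comps_of_mem_leastClass hQL
    have hP1 : P.card = 1 := card_eq_one_of_disjoint P Q x (nonempty_of_mem_comps hPc)
      (nonempty_of_mem_comps hQc) hPQ (hx P hPL) (hx Q hQL)
    obtain ⟨y, hPy⟩ := card_eq_one.1 hP1
    have hyc : y = c := by rw [hPy, mem_singleton] at hcP; exact hcP.symm
    subst hyc
    have hReq : U.erase y = Q := by
      rw [hUPQ, hPy, ← insert_eq, erase_insert (disjoint_singleton_left.1 (hPy ▸ hPQ))]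
    rw [hReq]
    refine ⟨hQc, fun W hW hcW hWne => lab_lt_of_not_mem_leastClass hQL hW fun hWL => ?_⟩
    rcases honly' W hWL with rfl | rfl
    · exact hcW (hPy ▸ mem_singleton_self y)
    · exact hWne rfl
  · -- two oldest components covering: they are pairs, `U` is everything, `R` is the complementary pair
    have hUeq : U = univ := univ_subset_iff.1 (hcov ▸ union_subset hS1U hS2U)
    have hndis : ¬ Disjoint S1 S2 := fun hdis => hG ⟨⟨S1, hS1L, S2, hS2L, hdis⟩, fun x => by
      rcases mem_union.1 (hcov.symm ▸ mem_univ x : x ∈ S1 ∪ S2) with h | h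
      · exact ⟨S1, hS1L, h⟩
      · exact ⟨S2, hS2L, h⟩⟩
    have hsmall : ∀ x : Fin 3, s.a x < m := by
      intro x
      rcases singleton_ssubset_of_union_eq_univ S1 S2 x h12 h21 hndis hcov with h | h
      · simpa using sum_lt_of_ssubset hS1c h (singleton_nonempty x)
      · simpa using sum_lt_of_ssubset hS2c h (singleton_nonempty x)
    have hRc : U.erase c ∈ comps m s.a := by
      refine mem_comps_of (hUeq ▸ erase_univ_nonempty c) hR fun T hT hTne => ?_
      obtain ⟨x, -, rfl⟩ := eq_singleton_of_ssubset_erase c T (hUeq ▸ hT) hTne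
      simpa using hsmall x
    refine ⟨hRc, fun W hW hcW hWne => absurd (eq_of_subset_of_mem_comps hRc hW fun y hy => ?_) hWne⟩
    rw [hUeq]
    exact mem_erase.2 ⟨fun h => hcW (h ▸ hy), mem_univ y⟩

/-- Arrangement move from a `Good` position: the flat `U` (union of ≥ 2 oldest index sets) followed into chart `c ∈ U`.
With `R = U ∖ {c}`: if `a_R < m` the order `|a|` drops; otherwise `R` is a component on both sides, it is the ONLY oldest
component afterwards, and `rho1' = |a'| − (a_R − m) = |a|` while `arr0` drops to `1`. [folklore] -/
theorem rank_lt_of_step_arr {s s' : State} (hG : Good m s) {sub : Finset (Finset (Fin 3))} {c : Fin 3}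
    (hsub : sub ⊆ leastClass m s) (hcard : 2 ≤ sub.card) (hcU : c ∈ sub.biUnion id)
    (ha : s'.a = transform m s.a (sub.biUnion id) c)
    (hlab : ∀ S ∈ comps m s'.a, s'.lab S = newLabel m s false (sub.biUnion id) c S) :
    rank m s' < rank m s := by
  set U := sub.biUnion id with hUdef
  obtain ⟨S1, hS1, S2, hS2, hne⟩ := (Finset.one_lt_card (s := sub)).1 (by omega)
  have hS1c := mem_comps_of_mem_leastClass (hsub hS1)
  have harr : 2 ≤ arr0 m s := le_trans hcard (card_le_card hsub)
  have hrho : rho1 m s = total s.a := by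
    have : arr0 m s ≠ 1 := by omega
    simp [rho1, this]
  have hS1U : S1 ⊆ U := subset_biUnion_of_mem id hS1
  have hbigU : m ≤ ∑ i ∈ U, s.a i := le_trans (le_sum_of_mem_comps hS1c) (sum_le_sum_of_subset hS1U)
  have htot := total_transform (m := m) (a := s.a) (c := c) hbigU
  rw [← ha] at htot
  have hsplit : ∑ i ∈ U, s.a i = s.a c + ∑ i ∈ U.erase c, s.a i := (add_sum_erase U s.a hcU).symm
  have hrho'le := rho1_le_total (m := m) (s := s')
  rw [rank_lt_iff, hrho]
  by_cases hR : ∑ i ∈ U.erase c, s.a i < m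
  · left; omega
  · rw [not_lt] at hR
    obtain ⟨hRcomp, hRmin⟩ := arr_survivor hG hsub hcard hcU hR
    rw [← hUdef] at hRcomp hRmin
    have hRc' : U.erase c ∈ comps m s'.a := by
      rw [ha]; exact mem_comps_transform_of_mem_comps (notMem_erase c U) hRcomp
    have hlabR : s'.lab (U.erase c) = s.lab (U.erase c) := by
      rw [hlab _ hRc']; simp [newLabel]
    have hLC' : leastClass m s' = {U.erase c} := by
      ext W
      simp only [mem_singleton]
      constructor
      · intro hW
        by_contra hWne
        have hWc' := mem_comps_of_mem_leastClass hW
        have hle := (mem_leastClass.1 hW).2 _ hRc'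
        rw [hlabR] at hle
        by_cases hcW : c ∈ W
        · have hWf : s'.lab W = fresh m s := by rw [hlab W hWc']; simp [newLabel, hcW]
          have := lab_lt_fresh hRcomp
          omega
        · have hWc := mem_comps_of_mem_comps_transform hcW (ha ▸ hWc')
          have hlabW : s'.lab W = s.lab W := by rw [hlab W hWc']; simp [newLabel, hcW]
          have := hRmin W hWc hcW hWne
          omega
      · rintro rfl
        refine mem_leastClass.2 ⟨hRc', fun T hT => ?_⟩
        rw [hlabR, hlab T hT]
        by_cases hcT : c ∈ T
        · simp only [newLabel, hcT, not_true_eq_false, if_false, Bool.false_eq_true, false_and]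
          exact le_of_lt (lab_lt_fresh hRcomp)
        · simp only [newLabel, hcT, not_false_eq_true, if_true]
          have hTc := mem_comps_of_mem_comps_transform hcT (ha ▸ hT)
          by_cases hTR : T = U.erase c
          · rw [hTR]
          · exact le_of_lt (hRmin T hTc hcT hTR)
    have harr' : arr0 m s' = 1 := by simp [arr0, hLC']
    have hexc' : exc0 m s' = ∑ i ∈ U.erase c, s'.a i - m := by simp [exc0, hLC']
    have hsumR' : ∑ i ∈ U.erase c, s'.a i = ∑ i ∈ U.erase c, s.a i := by
      rw [ha]; exact sum_transform_of_not_mem (notMem_erase c U)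
    have hrho' : rho1 m s' = total s'.a - (∑ i ∈ U.erase c, s'.a i - m) := by simp [rho1, harr', hexc']
    right
    exact ⟨by omega, Or.inl (by omega)⟩

/-! ## (L2) assembled, and the termination theorem -/

/-- **(L2)** From a `Good` position every move strictly lowers the rank (for `0 < m`). [folklore] -/
theorem rank_lt_of_step (hm : 0 < m) {s s' : State} (hG : Good m s) (h : Step m s s') : rank m s' < rank m s := by
  obtain ⟨isEnd, U, c, hcen, hcU, ha, hlab⟩ := h
  cases hcen with
  | end_ S₀ hLC => exact rank_lt_of_step_end hm hLC hcU ha hlab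
  | arr sub hsub hcard => exact rank_lt_of_step_arr hG hsub hcard hcU ha hlab

/-- `Good` positions are accessible: induction on the rank, using (L1) and (L2). [folklore] -/
theorem acc_of_good (hm : 0 < m) : ∀ s : State, Good m s → Acc (flip (Step m)) s := by
  suffices h : ∀ (r : ℕ ×ₗ ℕ ×ₗ ℕ) (s : State), rank m s = r → Good m s → Acc (flip (Step m)) s from
    fun s hs => h _ s rfl hs
  intro r
  induction r using WellFoundedLT.induction with
  | ind r ih =>
    intro s hr hs
    exact Acc.intro s fun s' hs' => ih (rank m s') (hr ▸ rank_lt_of_step hm hs hs') s' rfl (good_of_step hs')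

/-- **[OURS · L1 W4.2] The CJS label strategy wins the one-vertex polyhedra game in dimension 3**: for `0 < m` there is
no infinite play of the vertex game — from every position, every labelling, against every chart sequence. The toric
shadow of the CORE row `stub_Wtop3M_nonpointed` / of the items `CampaignW42NearChainTermination` (stmt-…-19964) and
`CampaignW42TertiaryTermination` (stmt-…-19965); a theorem about the validated model, NOT about schemes and NOT a
statement of the manuscript. [folklore] -/
theorem labelStrategyWins (hm : 0 < m) : LabelStrategyWins m :=
  ⟨fun s => Acc.intro s fun s' hs' => acc_of_good hm s' (good_of_step hs')⟩

/-- Corollary: no infinite play `f 0 → f 1 → f 2 → …`. [folklore] -/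
theorem no_infinite_play (hm : 0 < m) (f : ℕ → State) : ¬ ∀ n, Step m (f n) (f (n + 1)) := fun hf => by
  have key : ∀ s, Acc (flip (Step m)) s → ∀ n, f n ≠ s := by
    intro s hacc
    induction hacc with
    | intro s _ ih => intro n hn; exact ih (f (n + 1)) (hn ▸ hf n) (n + 1) rfl
  exact key (f 0) ((labelStrategyWins hm).apply (f 0)) 0 rfl

end CampaignW42.VertexGame

end Summit.ResolutionOfSingularities.ResolutionOfSingularities.Theorems
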